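import Summits.ABC.ABC.Theorems.DefiniteXiDefiniteRTControlPrime
import Literature.NumberTheory.EllipticCurves.ManinConstantArbitraryParametrizationIntegralProofs
import Literature.NumberTheory.EllipticCurves.TakahashiDegreeFormulaFromDictionaryHolds
import Literature.NumberTheory.Automorphic.ShimuraCurveRibetTakahashiSemistableManinProofs
import Literature.NumberTheory.Automorphic.ShimuraCurveRibetTakahashiPairwiseEisensteinProofs
import Literature.NumberTheory.EllipticCurves.IsogenyConductorModularityProofs
import Literature.NumberTheory.EllipticCurves.EichlerBasisTheoremOfTraceIdentity
import Literature.NumberTheory.EllipticCurves.FreyHellegouarchNormalizedCurveProofs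
import Literature.NumberTheory.EllipticCurves.SzpiroLocalDataProofs
import Literature.NumberTheory.EllipticCurves.DegreeConjectureAbcMurtyProofs
import Literature.NumberTheory.DiophantineGeometry.ConductorExponentLeEightProofs
import HarnessLib

/-!
# Stub ideation k2, GEN 6 (FAMILY 2 — RESHAPE) for `stub_takahashi : takahashi2001_thm_2_3_of_coprime`
# (crux `DefiniteXi.DefiniteRTControlPrime`, stmt-ABC-11338) — companion of `STUB-IDEAS-stub_takahashi-2.md` (gen 6)

k2 gens 2–5 stand by reference (`StubIdeas2G{2,3,4,5}TakahashiSketch.lean`, all sorry-free); this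
file repeats VERBATIM the gen-5 regime vocabulary it needs (§0: `Cruxes/` modules are not built on the
farm, so the gen-5 companion cannot be imported) and adds the kernel-checked content of the gen-6 memo:

* §1 **R6-A — NECESSITY (reformulate).** The crux forces `brandtXi (N/q) q (a(E_{a,b})) ≠ 0` at
  every Frey level carrying a parametrisation (`freyXiNeZero_of_crux`: with `ξ = 0` the bound reads
  `deg D ≤ C · N^ε · 0`, contradicting `deg D ≥ 1`; the idle `N^ε` and the constant cannot absorb the
  junk value), hence RANK ONE of the `a(E)`-eigen-lattice of the Brandt matrices for the setup
  realising `brandtXi` (`rankOne_at_frey_levels_of_crux`).  So the multiplicity-one leaf H1, restricted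
  to Frey levels `(2^e M', q)` and Frey eigen-systems, is a COROLLARY of the crux: no line through this
  crux avoids it; only the dictionary D1 is specific to Takahashi's line.
* §2 **R6-B — the regime split pushed through the CRUX.** `DefiniteRTControlPrimeAt goodN` (the crux on
  Frey conductors `N` with `goodN N`), `crux ↔ At ⊤`, union with `C = max C₁ C₂`, and the clone of the
  landed composition consuming the stub only where `goodN (M q) → good M`
  (`definiteRTControlPrimeAt_of`).  Instances (sorry-free): the SEMISTABLE regime of the crux holds from
  the reviewed square-free dictionary and Mazur–Kenku alone (`at_squarefree_of_dictionary`); the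
  residual regime `¬ Squarefree N` from the stub at two-additive cofactors
  (`at_not_squarefree_of`), or from the scoped leaves `D1At`/`H1At` resp. `D1At` + the scoped
  Eichler–Pizer trace identity (`TraceIdentityAt`, k3's H0 in regime form, `h1At_of_traceIdentityAt`).
* §3 scope of the residual regime: `ord_p N ≤ 8` for every curve over `ℚ`
  (`factorization_conductorNorm_le_eight`), the residual cofactors are `M = 2^e M'`, `2 ≤ e ≤ 8`, `M'`
  odd square-free (`twoAdditive_scope`); for Serre-normalised pairs `ord₂ N ∈ {0, 1, 3, 5}`
  (`factorization_two_mem_of_normalised`); the residual regime is met (`(a, b) = (3, 2)`: `2⁵ ∥ N`, `5 ∣ N`).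
-/

set_option linter.dupNamespace false

noncomputable section

namespace Summit.ABC.ABC.Cruxes.DefiniteRTControlPrime.StubIdeas2G6

open Summit.ABC.ABC.Theses.DefiniteXi
open Summit.ABC.ABC.Theorems.DefiniteRTControlPrime
open Literature.NumberTheory.EllipticCurves Literature.NumberTheory.EllipticCurves.ModularForms
open Literature.NumberTheory.Automorphic WeierstrassCurve
open Literature.NumberTheory.Automorphic.HeckeTraceFormulaGL2Level
open Literature.NumberTheory.EllipticCurves.BrandtJL
open ArithmeticFunction
open scoped BigOperators ArithmeticFunction.sigma


/-! ## §0 Gen-5 regime vocabulary (verbatim from `StubIdeas2G5TakahashiSketch.lean`, all proved there and here) -/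

/-- The stub's statement restricted to cofactors `M` with `good M` (gen 5). -/
def TakahashiCoprimeAt (good : ℕ → Prop) : Prop :=
  ∀ (W : WeierstrassCurve ℚ) [W.IsElliptic] (M r : ℕ) [NeZero (M * r)],
    good M → r.Prime → M.Coprime r → W.conductorNorm ℤ = M * r →
    ∀ P : ModularParametrizationData W (M * r),
      (∀ (W' : WeierstrassCurve ℚ) [W'.IsElliptic], W'.conductorNorm ℤ = M * r →
          ∀ P' : ModularParametrizationData W' (M * r),
          P'.f = P.f → P.modularDegree ≤ P'.modularDegree) →
      ∀ S : Brandt.XiSetup M r,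
        ∃ i j : ℕ, 0 < i ∧ i * j = (W.minimalDiscriminantNorm ℤ).factorization r ∧
          i ∣ S.xi (fun n => W.LFunction n) ∧
          P.modularDegree * i = S.xi (fun n => W.LFunction n) * j

/-- The full stub is the regime `⊤` (gen 5). -/
theorem stub_iff_at_true : takahashi2001_thm_2_3_of_coprime ↔ TakahashiCoprimeAt fun _ => True := by
  constructor
  · intro h W _ M r _ _ hr hcop hN P hmin S
    exact h W M r hr hcop hN P hmin S
  · intro h W _ M r _ hr hcop hN P hmin S
    exact h W M r trivial hr hcop hN P hmin S

theorem TakahashiCoprimeAt.mono {A B : ℕ → Prop} (hAB : ∀ M, A M → B M)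
    (h : TakahashiCoprimeAt B) : TakahashiCoprimeAt A :=
  fun W _ M r _ hA hr hcop hN P hmin S => h W M r (hAB M hA) hr hcop hN P hmin S

/-- The corollary shape consumed by the composition, for any regime (gen 5). -/
theorem TakahashiCoprimeAt.modularDegree_le_brandtXi_mul {good : ℕ → Prop}
    (h : TakahashiCoprimeAt good) (W : WeierstrassCurve ℚ) [W.IsElliptic] (M r : ℕ) [NeZero (M * r)]
    (hM : good M) (hr : r.Prime) (hcop : M.Coprime r) (hN : W.conductorNorm ℤ = M * r)
    (P : ModularParametrizationData W (M * r))
    (hmin : ∀ (W' : WeierstrassCurve ℚ) [W'.IsElliptic], W'.conductorNorm ℤ = M * r →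
      ∀ P' : ModularParametrizationData W' (M * r),
        P'.f = P.f → P.modularDegree ≤ P'.modularDegree) :
    P.modularDegree ≤
      brandtXi M r (fun n => W.LFunction n) * (W.minimalDiscriminantNorm ℤ).factorization r := by
  obtain ⟨S, hS⟩ := exists_brandtXi_eq (takahashi2001_thm_2_3_of_coprime.nonempty_xiSetup' hr hcop)
    (fun n => W.LFunction n)
  rw [hS]
  obtain ⟨i, j, hi, hij, -, hδ⟩ := h W M r hM hr hcop hN P hmin S
  calc P.modularDegree ≤ P.modularDegree * i := Nat.le_mul_of_pos_right _ hi
    _ = S.xi (fun n => W.LFunction n) * j := hδ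
    _ ≤ S.xi (fun n => W.LFunction n) * (i * j) :=
        Nat.mul_le_mul_left _ (Nat.le_mul_of_pos_left _ hi)
    _ = _ := by rw [hij]

/-- SEAM (gen 5, proved): at a square-free LEVEL conductor-restricted minimality is minimality among all
curves with the same newform (`IsNewformOf.level_eq_conductorNorm_of_squarefree_level`). -/
theorem minimal_of_conductorMinimal_of_squarefree {W : WeierstrassCurve ℚ} [W.IsElliptic] {N : ℕ}
    [NeZero N] (hsq : Squarefree N) (P : ModularParametrizationData W N)
    (hmin : ∀ (W' : WeierstrassCurve ℚ) [W'.IsElliptic], W'.conductorNorm ℤ = N →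
      ∀ P' : ModularParametrizationData W' N, P'.f = P.f → P.modularDegree ≤ P'.modularDegree)
    (W' : WeierstrassCurve ℚ) [W'.IsElliptic] (P' : ModularParametrizationData W' N)
    (hP' : P'.f = P.f) : P.modularDegree ≤ P'.modularDegree :=
  hmin W' (P'.isNewformOf.level_eq_conductorNorm_of_squarefree_level hsq).symm P' hP'

/-- The square-free regime of the STUB from the reviewed square-free dictionary (gen 5). -/
theorem takahashiAt_squarefree_of_dictionary (hD : takahashi2001_characterGroupDictionary) :
    TakahashiCoprimeAt Squarefree := by
  have h : takahashi2001_thm_2_3 :=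
    takahashi2001_thm_2_3_holds_of takahashi2001_brandtEigenLattice_rank_one_holds hD
  intro W _ M r _ hM hr hcop hN P hmin S
  have hsq : Squarefree (M * r) := (Nat.squarefree_mul hcop).mpr ⟨hM, hr.squarefree⟩
  exact h W M r hr hsq hN P (minimal_of_conductorMinimal_of_squarefree hsq P hmin) S

/-- Cofactors `M = N/q` of Frey conductors: `M ∣ 2⁸ · R` with `R` squarefree (gen 5). -/
def IsFreyCofactor (M : ℕ) : Prop := ∃ R : ℕ, Squarefree R ∧ M ∣ 2 ^ 8 * R

/-- The additive-at-`2` cofactors: `M = 2^e · M'`, `e ≥ 2`, `M'` odd squarefree (gen 5). -/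
def IsTwoAdditiveCofactor (M : ℕ) : Prop :=
  ∃ e M' : ℕ, 2 ≤ e ∧ Odd M' ∧ Squarefree M' ∧ M = 2 ^ e * M'

/-- Every cofactor met by the composition is a Frey cofactor (gen 5). -/
theorem isFreyCofactor_of_freyCurve (a b : ℤ) (hab : IsCoprime a b) (h0 : a * b * (a + b) ≠ 0)
    {M q : ℕ} (hN : (freyCurve a b).conductorNorm ℤ = M * q) : IsFreyCofactor M := by
  refine ⟨(UniqueFactorizationMonoid.radical (a * b * (a + b))).natAbs,
    Int.squarefree_natAbs.mpr UniqueFactorizationMonoid.squarefree_radical, ?_⟩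
  have h := conductorNorm_freyCurve_dvd_holds a b hab h0
  rw [hN] at h
  exact (Dvd.intro q rfl).trans h

/-- Elementary dichotomy: a nonzero Frey cofactor is squarefree or two-additive (gen 5). -/
theorem squarefree_or_twoAdditive_of_isFreyCofactor {M : ℕ} (hM0 : M ≠ 0) (hM : IsFreyCofactor M) :
    Squarefree M ∨ IsTwoAdditiveCofactor M := by
  obtain ⟨R, hR, hdvd⟩ := hM
  by_cases hsq : Squarefree M
  · exact Or.inl hsq
  right
  obtain ⟨e, M', hodd, hM⟩ := Nat.exists_eq_two_pow_mul_odd hM0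
  have hM'dvd : M' ∣ 2 ^ 8 * R := (Dvd.intro_left (2 ^ e) hM.symm).trans hdvd
  have hcop : Nat.Coprime M' (2 ^ 8) := Nat.Coprime.pow_right 8 (Nat.coprime_two_right.mpr hodd)
  have hM'R : M' ∣ R := hcop.dvd_of_dvd_mul_left hM'dvd
  have hM'sq : Squarefree M' := hR.squarefree_of_dvd hM'R
  refine ⟨e, M', ?_, hodd, hM'sq, hM⟩
  by_contra he
  have he' : e < 2 := Nat.lt_of_not_le he
  interval_cases e
  · exact hsq (by simpa [hM] using hM'sq)
  · apply hsq
    rw [hM, pow_one]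
    exact (Nat.squarefree_mul (Nat.coprime_two_left.mpr hodd)).mpr ⟨Nat.prime_two.squarefree, hM'sq⟩

/-- k1's dictionary leaf D1 restricted to cofactors with `good M` (gen 5). -/
def D1At (good : ℕ → Prop) : Prop :=
  ∀ (W : WeierstrassCurve ℚ) [W.IsElliptic] (M r : ℕ) [NeZero (M * r)],
    good M → r.Prime → M.Coprime r → W.conductorNorm ℤ = M * r →
    ∀ P : ModularParametrizationData W (M * r),
      (∀ (W' : WeierstrassCurve ℚ) [W'.IsElliptic], W'.conductorNorm ℤ = M * r →
          ∀ P' : ModularParametrizationData W' (M * r),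
          P'.f = P.f → P.modularDegree ≤ P'.modularDegree) →
      ∀ (S : Brandt.XiSetup M r) [Fintype (Brandt.ClassSet S.O)],
        ∃ (X : Submodule ℤ (Brandt.ClassSet S.O → ℤ)) (pb : ℤ →ₗ[ℤ] X) (pf : X →ₗ[ℤ] ℤ),
          (∀ (a : ℤ) (y : X),
              ∑ i, (Brandt.weight S.O i : ℤ) * (pb a : Brandt.ClassSet S.O → ℤ) i *
                  (y : Brandt.ClassSet S.O → ℤ) i =
                ((W.minimalDiscriminantNorm ℤ).factorization r : ℤ) * a * pf y) ∧
          (∀ a : ℤ, pf (pb a) = (P.modularDegree : ℤ) * a) ∧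
          Function.Surjective pf ∧
          (∀ (m : ℤ) (v : Brandt.ClassSet S.O → ℤ), m ≠ 0 → m • v ∈ X → v ∈ X) ∧
          (∀ v : Brandt.ClassSet S.O → ℤ, ∑ i, v i = 0 → v ∈ X) ∧
          (pb 1 : Brandt.ClassSet S.O → ℤ) ∈
            Brandt.eigenLattice (M * r) (Brandt.matrix S.O) (fun n => W.LFunction n)

/-- k1/k3's multiplicity-one leaf H1 restricted to cofactors with `good M` (gen 5). -/
def H1At (good : ℕ → Prop) : Prop :=
  ∀ (W : WeierstrassCurve ℚ) [W.IsElliptic] (M r : ℕ) [NeZero (M * r)],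
    good M → r.Prime → M.Coprime r → W.conductorNorm ℤ = M * r →
    ∀ (_P : ModularParametrizationData W (M * r)) (S : Brandt.XiSetup M r)
      [Fintype (Brandt.ClassSet S.O)],
      Module.finrank ℤ
        (Brandt.eigenLattice (M * r) (Brandt.matrix S.O) (fun n => W.LFunction n)) = 1

/-- Leaves ⇒ regime (gen 5, via the tree's `exists_image_coker_eisenstein_of_brandtData`). -/
theorem at_of_D1At_of_H1At {good : ℕ → Prop} (hD : D1At good) (h1 : H1At good) :
    TakahashiCoprimeAt good := by
  intro W _ M r _ hM hr hcop hN P hmin S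
  classical
  letI : Fintype (Brandt.ClassSet S.O) := Fintype.ofFinite _
  obtain ⟨X, pb, pf, hadj, hδ, hsurj, hsat, hdeg, hmem⟩ := hD W M r hM hr hcop hN P hmin S
  obtain ⟨i, j, hi, hij, hiξ, hδi, -⟩ := exists_image_coker_eisenstein_of_brandtData W M r hr hN P S
    X pb pf hadj hδ hsurj hsat hdeg (h1 W M r hM hr hcop hN P S) hmem
  exact ⟨i, j, hi, hij, hiξ, hδi⟩

/-! ## §1 R6-A — NECESSITY: the crux forces `ξ ≠ 0`, i.e. rank one, at every Frey level -/

section Line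

variable {ι : Type*} [Fintype ι]

/-- `ξ(L) ≠ 0` only on lines (contrapositive of the junk-value clause `Brandt.xi_of_not_isLine`). -/
theorem isLine_of_xi_ne_zero (w : ι → ℕ) {L : Submodule ℤ (ι → ℤ)} (h : Brandt.xi w L ≠ 0) :
    ∃ φ : ι → ℤ, φ ≠ 0 ∧ L = Submodule.span ℤ {φ} := by
  by_contra hL
  exact h (Brandt.xi_of_not_isLine w hL)

/-- `ξ(L) ≠ 0 ⇒ rank L = 1`. -/
theorem finrank_eq_one_of_xi_ne_zero (w : ι → ℕ) {L : Submodule ℤ (ι → ℤ)}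
    (h : Brandt.xi w L ≠ 0) : Module.finrank ℤ L = 1 := by
  obtain ⟨φ, hφ, rfl⟩ := isLine_of_xi_ne_zero w h
  rw [← (LinearEquiv.toSpanNonzeroSingleton ℤ (ι → ℤ) φ hφ).finrank_eq, Module.finrank_self]

end Line

/-- For a Brandt setup: `S.xi λ ≠ 0 ⇒` the `λ`-eigen-lattice of its Brandt matrices has rank one. -/
theorem finrank_eigenLattice_eq_one_of_xi_ne_zero {M r : ℕ} (S : Brandt.XiSetup M r)
    [Fintype (Brandt.ClassSet S.O)] (lam : ℕ → ℤ) (h : S.xi lam ≠ 0) :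
    Module.finrank ℤ (Brandt.eigenLattice (M * r) (Brandt.matrix S.O) lam) = 1 := by
  rw [Brandt.XiSetup.xi, Brandt.xiOfOrder_eq] at h
  exact finrank_eq_one_of_xi_ne_zero _ h

/-- `brandtXi ≠ 0 ⇒` a setup of that type exists (else `brandtXi` is the junk value `0`). -/
theorem nonempty_xiSetup_of_brandtXi_ne_zero {M r : ℕ} {lam : ℕ → ℤ} (h : brandtXi M r lam ≠ 0) :
    Nonempty (Brandt.XiSetup M r) := by
  by_contra hS
  exact h (brandtXi_of_isEmpty (not_nonempty_iff.mp hS) lam)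

/-- `brandtXi ≠ 0 ⇒` rank one for the setup realising it. -/
theorem exists_finrank_eq_one_of_brandtXi_ne_zero {M r : ℕ} {lam : ℕ → ℤ}
    (h : brandtXi M r lam ≠ 0) :
    ∃ S : Brandt.XiSetup M r, brandtXi M r lam = S.xi lam ∧
      ∀ [Fintype (Brandt.ClassSet S.O)],
        Module.finrank ℤ (Brandt.eigenLattice (M * r) (Brandt.matrix S.O) lam) = 1 := by
  obtain ⟨S, hS⟩ := exists_brandtXi_eq (nonempty_xiSetup_of_brandtXi_ne_zero h) lam
  refine ⟨S, hS, ?_⟩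
  intro _
  exact finrank_eigenLattice_eq_one_of_xi_ne_zero S lam fun h0 => h (hS.trans h0)

/-- `ξ ≠ 0` at every Frey level carrying a modular parametrisation. -/
def FreyXiNeZero : Prop :=
  ∀ a b : ℤ, IsCoprime a b → a * b * (a + b) ≠ 0 → ∀ (N : ℕ) [NeZero N],
    (freyCurve a b).conductorNorm ℤ = N → ∀ q : ℕ, q.Prime → q ≠ 2 → q ∣ N →
    Nonempty (ModularParametrizationData (freyCurve a b) N) →
    brandtXi (N / q) q (fun n => (freyCurve a b).LFunction n) ≠ 0

/-- **R6-A (NECESSITY), step 1.** The crux (with `ε := 1`) forces `ξ ≠ 0`: with `ξ = 0` its bound is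
`deg D ≤ C · N · 0 = 0` for the minimal datum `D`, against `deg D ≥ 1` (`deg_pos`). -/
theorem freyXiNeZero_of_crux (h : DefiniteRTControlPrime) : FreyXiNeZero := by
  intro a b hab h0 N _ hN q hq hq2 hqN hne hξ
  obtain ⟨C, hC⟩ := h 1 one_pos
  obtain ⟨D, -, hDmin⟩ := exists_minimal_datum hne
  have hle := hC a b hab h0 N hN q hq hq2 hqN D hDmin
  rw [hξ, Nat.cast_zero, zero_mul, mul_zero] at hle
  have hpos : (0 : ℝ) < (D.deg : ℝ) := by exact_mod_cast D.deg_pos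
  exact absurd hle (not_le.mpr hpos)

/-- **R6-A (NECESSITY), step 2.** Any proof of the crux proves RANK ONE of the `a(E_{a,b})`-eigen-lattice
of the Brandt matrices at every Frey level `(N/q, q)` — for the setup realising `brandtXi`, in
particular at the additive-at-`2` levels `N/q = 2^e M'`.  H1 ∩ (Frey levels, Frey eigen-systems) is a
corollary of the crux. -/
theorem rankOne_at_frey_levels_of_crux (h : DefiniteRTControlPrime) (a b : ℤ) (hab : IsCoprime a b)
    (h0 : a * b * (a + b) ≠ 0) (N : ℕ) [NeZero N] (hN : (freyCurve a b).conductorNorm ℤ = N)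
    (q : ℕ) (hq : q.Prime) (hq2 : q ≠ 2) (hqN : q ∣ N)
    (hne : Nonempty (ModularParametrizationData (freyCurve a b) N)) :
    ∃ S : Brandt.XiSetup (N / q) q,
      brandtXi (N / q) q (fun n => (freyCurve a b).LFunction n) =
          S.xi (fun n => (freyCurve a b).LFunction n) ∧
        ∀ [Fintype (Brandt.ClassSet S.O)],
          Module.finrank ℤ (Brandt.eigenLattice (N / q * q) (Brandt.matrix S.O)
            (fun n => (freyCurve a b).LFunction n)) = 1 :=
  exists_finrank_eq_one_of_brandtXi_ne_zero (freyXiNeZero_of_crux h a b hab h0 N hN q hq hq2 hqN hne)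

/-- Contrapositive (the crux's cheapest GLOBAL falsifier): one Frey level with a parametrisation and
`brandtXi = 0` (rank `≠ 1` for the chosen setup) refutes the crux. -/
theorem not_crux_of_brandtXi_eq_zero {a b : ℤ} (hab : IsCoprime a b) (h0 : a * b * (a + b) ≠ 0)
    {N : ℕ} [NeZero N] (hN : (freyCurve a b).conductorNorm ℤ = N) {q : ℕ} (hq : q.Prime)
    (hq2 : q ≠ 2) (hqN : q ∣ N) (hne : Nonempty (ModularParametrizationData (freyCurve a b) N))
    (hξ : brandtXi (N / q) q (fun n => (freyCurve a b).LFunction n) = 0) :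
    ¬ DefiniteRTControlPrime := fun h =>
  freyXiNeZero_of_crux h a b hab h0 N hN q hq hq2 hqN hne hξ

/-- **R6-A for the STUB itself.** The stub's identity `deg · i = ξ_S · j` with `0 < i` forces
`S.xi ≠ 0` for EVERY setup `S` of type `(M, r)`: whenever some curve of conductor `M r` carries a
conductor-restricted-minimal parametrisation, the `a(W)`-eigen-lattice of EVERY Eichler order of that
type has rank one.  H1 restricted to realised eigen-systems is a corollary of the stub (all setups),
as `rankOne_at_frey_levels_of_crux` is of the crux (realising setup, Frey levels). -/
theorem xi_ne_zero_of_stub (h : takahashi2001_thm_2_3_of_coprime) (W : WeierstrassCurve ℚ)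
    [W.IsElliptic] (M r : ℕ) [NeZero (M * r)] (hr : r.Prime) (hcop : M.Coprime r)
    (hN : W.conductorNorm ℤ = M * r) (P : ModularParametrizationData W (M * r))
    (hmin : ∀ (W' : WeierstrassCurve ℚ) [W'.IsElliptic], W'.conductorNorm ℤ = M * r →
      ∀ P' : ModularParametrizationData W' (M * r), P'.f = P.f → P.modularDegree ≤ P'.modularDegree)
    (S : Brandt.XiSetup M r) : S.xi (fun n => W.LFunction n) ≠ 0 := by
  intro hξ
  obtain ⟨i, j, hi, -, -, hdeg⟩ := h W M r hr hcop hN P hmin S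
  rw [hξ, zero_mul] at hdeg
  have hpos : 0 < P.modularDegree * i := Nat.mul_pos P.deg_pos hi
  exact absurd hdeg hpos.ne'

/-- Rank one for every setup, from the stub (cf. `rankOne_at_frey_levels_of_crux`). -/
theorem rankOne_of_stub (h : takahashi2001_thm_2_3_of_coprime) (W : WeierstrassCurve ℚ)
    [W.IsElliptic] (M r : ℕ) [NeZero (M * r)] (hr : r.Prime) (hcop : M.Coprime r)
    (hN : W.conductorNorm ℤ = M * r) (P : ModularParametrizationData W (M * r))
    (hmin : ∀ (W' : WeierstrassCurve ℚ) [W'.IsElliptic], W'.conductorNorm ℤ = M * r →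
      ∀ P' : ModularParametrizationData W' (M * r), P'.f = P.f → P.modularDegree ≤ P'.modularDegree)
    (S : Brandt.XiSetup M r) [Fintype (Brandt.ClassSet S.O)] :
    Module.finrank ℤ (Brandt.eigenLattice (M * r) (Brandt.matrix S.O) fun n => W.LFunction n) = 1 :=
  finrank_eigenLattice_eq_one_of_xi_ne_zero S _ (xi_ne_zero_of_stub h W M r hr hcop hN P hmin S)

/-! ## §2 R6-B — the regime split pushed through the crux -/

/-- The crux restricted to Frey conductors `N` with `goodN N` (binder inserted after `N_E = N`). -/
def DefiniteRTControlPrimeAt (goodN : ℕ → Prop) : Prop :=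
  ∀ ε : ℝ, 0 < ε → ∃ C : ℝ, ∀ a b : ℤ, IsCoprime a b → a * b * (a + b) ≠ 0 →
    ∀ (N : ℕ) [NeZero N], (freyCurve a b).conductorNorm ℤ = N → goodN N →
    ∀ q : ℕ, q.Prime → q ≠ 2 → q ∣ N →
    ∀ D : ModularParametrizationData (freyCurve a b) N,
      (∀ D' : ModularParametrizationData (freyCurve a b) N, D.deg ≤ D'.deg) →
      (D.deg : ℝ) ≤ C * (N : ℝ) ^ ε *
        ((brandtXi (N / q) q (fun n => (freyCurve a b).LFunction n) : ℝ) *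
          (((freyCurve a b).minimalDiscriminantNorm ℤ).factorization q : ℕ))

theorem crux_iff_at_true : DefiniteRTControlPrime ↔ DefiniteRTControlPrimeAt fun _ => True := by
  constructor
  · intro h ε hε
    obtain ⟨C, hC⟩ := h ε hε
    exact ⟨C, fun a b hab h0 N _ hN _ q hq hq2 hqN D hD => hC a b hab h0 N hN q hq hq2 hqN D hD⟩
  · intro h ε hε
    obtain ⟨C, hC⟩ := h ε hε
    exact ⟨C, fun a b hab h0 N _ hN q hq hq2 hqN D hD => hC a b hab h0 N hN trivial q hq hq2 hqN D hD⟩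

theorem DefiniteRTControlPrimeAt.mono {A B : ℕ → Prop} (hAB : ∀ N, A N → B N)
    (h : DefiniteRTControlPrimeAt B) : DefiniteRTControlPrimeAt A := by
  intro ε hε
  obtain ⟨C, hC⟩ := h ε hε
  exact ⟨C, fun a b hab h0 N _ hN hA q hq hq2 hqN D hD =>
    hC a b hab h0 N hN (hAB N hA) q hq hq2 hqN D hD⟩

/-- Union of regimes: `C = max C₁ C₂` (the right-hand side is monotone in `C` since `N^ε · ξ · v ≥ 0`). -/
theorem DefiniteRTControlPrimeAt.union {A B : ℕ → Prop} (hA : DefiniteRTControlPrimeAt A)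
    (hB : DefiniteRTControlPrimeAt B) : DefiniteRTControlPrimeAt fun N => A N ∨ B N := by
  intro ε hε
  obtain ⟨C₁, h₁⟩ := hA ε hε
  obtain ⟨C₂, h₂⟩ := hB ε hε
  refine ⟨max C₁ C₂, ?_⟩
  intro a b hab h0 N _ hN hAB q hq hq2 hqN D hD
  have hX : (0 : ℝ) ≤ (N : ℝ) ^ ε *
      ((brandtXi (N / q) q (fun n => (freyCurve a b).LFunction n) : ℝ) *
        (((freyCurve a b).minimalDiscriminantNorm ℤ).factorization q : ℕ)) := by positivity
  rcases hAB with hg | hg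
  · calc (D.deg : ℝ) ≤ _ := h₁ a b hab h0 N hN hg q hq hq2 hqN D hD
      _ ≤ _ := by
        rw [mul_assoc, mul_assoc]
        exact mul_le_mul_of_nonneg_right (le_max_left _ _) hX
  · calc (D.deg : ℝ) ≤ _ := h₂ a b hab h0 N hN hg q hq hq2 hqN D hD
      _ ≤ _ := by
        rw [mul_assoc, mul_assoc]
        exact mul_le_mul_of_nonneg_right (le_max_right _ _) hX

/-- RESHAPE R6-B: the crux is the conjunction of its semistable and its non-square-free regime. -/
theorem crux_of_at_squarefree_of_at_not (hA : DefiniteRTControlPrimeAt Squarefree)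
    (hB : DefiniteRTControlPrimeAt fun N => ¬ Squarefree N) : DefiniteRTControlPrime :=
  crux_iff_at_true.mpr ((hA.union hB).mono fun N _ => em (Squarefree N))

/-- **The composition with a regime binder (PROVED).**  Verbatim clone of the landed
`definiteRTControlPrime_of_facts` (p97354) / gen-5 `definiteRTControlPrime_of_at_freyCofactor`, with the
single Takahashi line now consuming `hT : TakahashiCoprimeAt good` at the cofactor `M = N/q` through a
user-supplied regime transfer `hgood : … → goodN (M q) → good M`. -/
theorem definiteRTControlPrimeAt_of {good goodN : ℕ → Prop} (hT : TakahashiCoprimeAt good)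
    (hgood : ∀ (a b : ℤ) (M q : ℕ), IsCoprime a b → a * b * (a + b) ≠ 0 → M ≠ 0 → q.Prime →
      q ≠ 2 → M.Coprime q → (freyCurve a b).conductorNorm ℤ = M * q → goodN (M * q) → good M)
    (h163 : PastenShimura2024_minimalDegree_le_163_mul) (h68 : PastenShimura2024_lemma_6_8) :
    DefiniteRTControlPrimeAt goodN := by
  intro ε hε
  refine ⟨4 * 163 * 163, ?_⟩
  intro a b hab h0 N _ hN hgoodN q hq hq2 hqN D hDmin
  -- `N = M q`
  obtain ⟨M, hM⟩ := hqN
  rw [mul_comm] at hM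
  subst hM
  haveI := isElliptic_freyCurve h0
  have hdiv : M * q / q = M := Nat.mul_div_cancel M hq.pos
  rw [hdiv]
  have hM0 : M ≠ 0 := fun h => NeZero.ne (M * q) (by rw [h, zero_mul])
  have hqN' : q ∣ (freyCurve a b).conductorNorm ℤ := by rw [hN]; exact Dvd.intro_left M rfl
  -- `gcd(M, q) = 1`
  have hcop : M.Coprime q := by
    have h := stub_freyLocal a b hab h0 q hq hq2 hqN'
    rwa [hN, hdiv] at h
  -- a global minimal model `W_m = C • E`, its data, a minimal one
  obtain ⟨C, hC⟩ := hasGlobalMinimalModel_rat_holds (freyCurve a b)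
  haveI := hC
  have hNm : (C • freyCurve a b).conductorNorm ℤ = M * q := by rw [conductorNorm_smul_rat, hN]
  have hne : Nonempty (ModularParametrizationData (C • freyCurve a b) (M * q)) :=
    (Summit.ABC.ABC.Theorems.nonempty_modularParametrizationData_smul_iff C).mpr ⟨D⟩
  obtain ⟨D₁, -, hD₁min⟩ := exists_minimal_datum hne
  -- the lattice-optimal datum of the class of `f₁ := D₁.f`
  obtain ⟨W₀, hW₀, D₀, hf₀, h₀⟩ := D₁.exists_optimalDatum'
  haveI := hW₀
  have hker₀ : D₀.isogenyMap.ker = ⊥ := D₀.isogenyMap_ker_eq_bot_iff.mpr h₀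
  have hmin₀ : ∀ (W' : WeierstrassCurve ℚ) [W'.IsElliptic]
      (D' : ModularParametrizationData W' (M * q)), D'.f = D₀.f →
        D₀.modularDegree ≤ D'.modularDegree := fun W' _ D' hD' =>
    D₀.modularDegree_le_of_isogenyMap_ker_eq_bot hker₀ D' hD'
  -- (T_deg) `deg D₁ ≤ 163 · deg D₀`
  have h163' : D₁.modularDegree ≤ 163 * D₀.modularDegree :=
    h163 (M * q) W₀ (C • freyCurve a b) D₀ D₁ hf₀.symm hmin₀ hD₁min
  -- the conductor-restricted optimal pivot `(W⋆, P⋆)`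
  obtain ⟨Ws, hWs, Ps, hNs, hfs, hPsmin⟩ := exists_conductorMinimal D₁ hNm
  haveI := hWs
  have h0s : D₀.modularDegree ≤ Ps.modularDegree := hmin₀ Ws Ps (hfs.trans hf₀.symm)
  -- Takahashi at `(W⋆, P⋆)`, in the regime `good M` supplied by `hgood`
  have hTak : Ps.modularDegree ≤ brandtXi M q (fun n => Ws.LFunction n) *
      (Ws.minimalDiscriminantNorm ℤ).factorization q :=
    hT.modularDegree_le_brandtXi_mul Ws M q (hgood a b M q hab h0 hM0 hq hq2 hcop hN hgoodN) hq
      hcop hNs Ps hPsmin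
  -- `a(W⋆) = a(f₁) = a(W_m) = a(E)`
  have hL : (fun n => Ws.LFunction n) = fun n => (freyCurve a b).LFunction n := by
    funext n
    have h1 := Ps.isNewformOf.2 n
    have h2 := D₁.isNewformOf.2 n
    rw [hfs] at h1
    rw [h1, LFunction_smul] at h2
    exact_mod_cast h2
  rw [hL] at hTak
  -- (T_val) along `E ~ W_m ~ W⋆`
  have hiso : (freyCurve a b).IsIsogenous Ws :=
    (isIsogenous_smul (freyCurve a b) C).trans' (isIsogenous_of_f_eq D₁ Ps hfs)
  have hval : (Ws.minimalDiscriminantNorm ℤ).factorization q ≤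
      163 * ((freyCurve a b).minimalDiscriminantNorm ℤ).factorization q :=
    stub_valTransport h68 a b hab h0 q hq hq2 hqN' Ws hiso
  -- (T_model) back to the Frey model
  obtain ⟨D₁', -, hdeg₁'⟩ := stub_smulTransportDeg C D₁
  have hscale : (C.u : ℚ).num.natAbs ≤ 2 := stub_freyScale a b hab h0 C hC
  have hD : D.deg ≤ 4 * D₁.modularDegree := by
    calc D.deg ≤ D₁'.deg := hDmin D₁'
      _ = (C.u : ℚ).num.natAbs ^ 2 * D₁.deg := hdeg₁'
      _ ≤ 2 ^ 2 * D₁.deg := Nat.mul_le_mul_right _ (Nat.pow_le_pow_left hscale 2)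
      _ = 4 * D₁.modularDegree := by norm_num [ModularParametrizationData.modularDegree]
  -- the chain in `ℕ`
  set ξ : ℕ := brandtXi M q (fun n => (freyCurve a b).LFunction n) with hξ
  set v : ℕ := ((freyCurve a b).minimalDiscriminantNorm ℤ).factorization q with hv
  have hchain : D.deg ≤ 4 * 163 * 163 * (ξ * v) :=
    calc D.deg ≤ 4 * D₁.modularDegree := hD
      _ ≤ 4 * (163 * D₀.modularDegree) := Nat.mul_le_mul_left _ h163'
      _ ≤ 4 * (163 * Ps.modularDegree) := Nat.mul_le_mul_left _ (Nat.mul_le_mul_left _ h0s)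
      _ ≤ 4 * (163 * (ξ * (Ws.minimalDiscriminantNorm ℤ).factorization q)) :=
          Nat.mul_le_mul_left _ (Nat.mul_le_mul_left _ hTak)
      _ ≤ 4 * (163 * (ξ * (163 * v))) :=
          Nat.mul_le_mul_left _ (Nat.mul_le_mul_left _ (Nat.mul_le_mul_left _ hval))
      _ = 4 * 163 * 163 * (ξ * v) := by ring
  -- to `ℝ`, inserting the idle `N^ε ≥ 1`
  have hN1 : (1 : ℝ) ≤ ((M * q : ℕ) : ℝ) := by
    exact_mod_cast Nat.one_le_iff_ne_zero.mpr (NeZero.ne (M * q))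
  have hrpow : (1 : ℝ) ≤ ((M * q : ℕ) : ℝ) ^ ε := Real.one_le_rpow hN1 hε.le
  have hcast : (D.deg : ℝ) ≤ (4 * 163 * 163 : ℝ) * ((ξ : ℝ) * (v : ℝ)) := by
    exact_mod_cast hchain
  have hξv : (0 : ℝ) ≤ (ξ : ℝ) * (v : ℝ) := by positivity
  calc (D.deg : ℝ) ≤ (4 * 163 * 163 : ℝ) * ((ξ : ℝ) * (v : ℝ)) := hcast
    _ = (4 * 163 * 163 : ℝ) * 1 * ((ξ : ℝ) * (v : ℝ)) := by ring
    _ ≤ (4 * 163 * 163 : ℝ) * ((M * q : ℕ) : ℝ) ^ ε * ((ξ : ℝ) * (v : ℝ)) := by gcongr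

/-- **The semistable regime of the CRUX is closed modulo two reviewed facts** (the square-free
character-group dictionary — a def already in the tree — and Mazur–Kenku): no new leaf, no `sorry`. -/
theorem at_squarefree_of_dictionary (hD₀ : takahashi2001_characterGroupDictionary)
    (hMK : mazurKenku_exists_cyclic_isogeny) : DefiniteRTControlPrimeAt Squarefree :=
  definiteRTControlPrimeAt_of (takahashiAt_squarefree_of_dictionary hD₀)
    (fun _ _ _ _ _ _ _ _ _ _ _ hsq => Squarefree.of_mul_left hsq)
    (PastenShimura2024_minimalDegree_le_163_mul_of_mazurKenku' hMK)
    (PastenShimura2024_lemma_6_8_of_mazurKenku' hMK)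

/-- The regime transfer for the residual regime: a non-square-free Frey conductor `M q` (`q` odd,
`gcd(M, q) = 1`) has a two-additive cofactor `M = 2^e M'`, `e ≥ 2`, `M'` odd square-free. -/
theorem isTwoAdditiveCofactor_of_not_squarefree {a b : ℤ} (hab : IsCoprime a b)
    (h0 : a * b * (a + b) ≠ 0) {M q : ℕ} (hM0 : M ≠ 0) (hq : q.Prime) (hcop : M.Coprime q)
    (hN : (freyCurve a b).conductorNorm ℤ = M * q) (hnsq : ¬ Squarefree (M * q)) :
    IsTwoAdditiveCofactor M :=
  (squarefree_or_twoAdditive_of_isFreyCofactor hM0 (isFreyCofactor_of_freyCurve a b hab h0 hN)).resolve_left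
    fun hsq => hnsq ((Nat.squarefree_mul hcop).mpr ⟨hsq, hq.squarefree⟩)

/-- The residual regime of the crux from the stub at two-additive cofactors only (+ Mazur–Kenku). -/
theorem at_not_squarefree_of (hB : TakahashiCoprimeAt IsTwoAdditiveCofactor)
    (hMK : mazurKenku_exists_cyclic_isogeny) : DefiniteRTControlPrimeAt fun N => ¬ Squarefree N :=
  definiteRTControlPrimeAt_of hB
    (fun _ _ _ _ hab h0 hM0 hq _ hcop hN hnsq =>
      isTwoAdditiveCofactor_of_not_squarefree hab h0 hM0 hq hcop hN hnsq)
    (PastenShimura2024_minimalDegree_le_163_mul_of_mazurKenku' hMK)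
    (PastenShimura2024_lemma_6_8_of_mazurKenku' hMK)

/-- R6-B assembled (sorry-free): crux ⟸ {square-free dictionary (reviewed), the stub at two-additive
cofactors, Mazur–Kenku}. -/
theorem crux_of_regimes (hD₀ : takahashi2001_characterGroupDictionary)
    (hB : TakahashiCoprimeAt IsTwoAdditiveCofactor) (hMK : mazurKenku_exists_cyclic_isogeny) :
    DefiniteRTControlPrime :=
  crux_of_at_squarefree_of_at_not (at_squarefree_of_dictionary hD₀ hMK) (at_not_squarefree_of hB hMK)

/-- k3's H0 (Eichler–Pizer trace identity, coprime form) restricted to cofactors with `good M`. -/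
def TraceIdentityAt (good : ℕ → Prop) : Prop :=
  ∀ (M r : ℕ) [NeZero M] [NeZero (M * r)], good M → r.Prime → M.Coprime r →
    ∀ (S : Brandt.XiSetup M r) [Fintype (Brandt.ClassSet S.O)], ∀ n : ℕ, 0 < n → n.Coprime (M * r) →
      cuspidalHeckeTrace (M * r) 2 1 n =
        (((Brandt.matrix S.O n).trace : ℤ) : ℂ) - ((σ 1 n : ℕ) : ℂ) + 2 * cuspidalHeckeTrace M 2 1 n

/-- H0 ⇒ H1 in any regime (the tree's `BrandtJL.finrank_eigenLattice_eq_one_of_traceIdentity`). -/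
theorem h1At_of_traceIdentityAt {good : ℕ → Prop} (h : TraceIdentityAt good) : H1At good := by
  intro W _ M r _ hM hr hcop _hN P S _
  haveI : NeZero M := ⟨fun hM0 => NeZero.ne (M * r) (by rw [hM0, zero_mul])⟩
  exact finrank_eigenLattice_eq_one_of_traceIdentity S (h M r hM hr hcop S) W hr.one_lt P

/-- R6-B with the leaves (sorry-free): crux ⟸ {square-free dictionary, D1 at two-additive cofactors
(k1's leaf, scoped), the trace identity at two-additive cofactors (k3's H0, scoped), Mazur–Kenku}.
By §1 the H0/H1 component cannot be removed by any line through this crux. -/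
theorem crux_of_regimes_leaves (hD₀ : takahashi2001_characterGroupDictionary)
    (hD : D1At IsTwoAdditiveCofactor) (hTr : TraceIdentityAt IsTwoAdditiveCofactor)
    (hMK : mazurKenku_exists_cyclic_isogeny) : DefiniteRTControlPrime :=
  crux_of_regimes hD₀ (at_of_D1At_of_H1At hD (h1At_of_traceIdentityAt hTr)) hMK

/-! ## §3 Scope of the residual regime -/

/-- `ord_p N_W ≤ 8` for every elliptic curve over `ℚ` and every `p` (`f_p ≤ 8`, tree theorem
`conductorExponent_le_eight_holds`, read through `factorization_conductorNorm`). -/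
theorem factorization_conductorNorm_le_eight (W : WeierstrassCurve ℚ) [W.IsElliptic] (p : ℕ) :
    (W.conductorNorm ℤ).factorization p ≤ 8 := by
  by_cases hp : p.Prime
  · rw [factorization_conductorNorm_primesEquiv_symm W ⟨p, hp⟩]
    exact WeierstrassCurve.conductorExponent_le_eight_holds W _
  · exact (Nat.factorization_eq_zero_of_not_prime _ hp).trans_le (Nat.zero_le _)

/-- SCOPE of the residual regime: the cofactor of a non-square-free Frey conductor is `2^e M'` with
`2 ≤ e ≤ 8`, `M'` odd square-free. -/
theorem twoAdditive_scope {a b : ℤ} (hab : IsCoprime a b) (h0 : a * b * (a + b) ≠ 0) {M q : ℕ}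
    (hM0 : M ≠ 0) (hq : q.Prime) (hq2 : q ≠ 2) (hcop : M.Coprime q)
    (hN : (freyCurve a b).conductorNorm ℤ = M * q) (hnsq : ¬ Squarefree (M * q)) :
    ∃ e M' : ℕ, 2 ≤ e ∧ e ≤ 8 ∧ Odd M' ∧ Squarefree M' ∧ M = 2 ^ e * M' := by
  haveI := isElliptic_freyCurve h0
  obtain ⟨e, M', he, hodd, hsq, hM⟩ := isTwoAdditiveCofactor_of_not_squarefree hab h0 hM0 hq hcop hN hnsq
  refine ⟨e, M', he, ?_, hodd, hsq, hM⟩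
  have h8 := factorization_conductorNorm_le_eight (freyCurve a b) 2
  rw [hN, hM] at h8
  have hM'0 : M' ≠ 0 := fun h => hM0 (by rw [hM, h, mul_zero])
  have hq0 : q ≠ 0 := hq.ne_zero
  have h2M' : (M').factorization 2 = 0 :=
    Nat.factorization_eq_zero_of_not_dvd fun h => (Nat.not_even_iff_odd.mpr hodd) (even_iff_two_dvd.mpr h)
  have h2q : q.factorization 2 = 0 := by
    rw [hq.factorization]
    simp [hq2]
  rw [Nat.factorization_mul (mul_ne_zero (pow_ne_zero _ two_ne_zero) hM'0) hq0,
    Nat.factorization_mul (pow_ne_zero _ two_ne_zero) hM'0, Finsupp.add_apply, Finsupp.add_apply,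
    Nat.Prime.factorization_pow Nat.prime_two, Finsupp.single_eq_same, h2M', h2q] at h8
  simpa using h8

/-- For Serre-normalised pairs (`A ≡ −1 (mod 4)`, `B` even) the tree's table gives
`ord₂ N ∈ {0, 1, 3, 5}` — so the normalised residual regime is `e ∈ {3, 5}` only. -/
theorem factorization_two_mem_of_normalised {A B : ℤ} (hAB : IsCoprime A B)
    (h0 : A * B * (A + B) ≠ 0) (hA : A ≡ -1 [ZMOD 4]) (hB : (2 : ℤ) ∣ B) :
    ((freyCurve A B).conductorNorm ℤ).factorization 2 ∈ ({0, 1, 3, 5} : Finset ℕ) := by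
  rw [factorization_two_conductorNorm_freyCurve_normalised hAB h0 hA hB]
  split_ifs <;> simp

/-- NON-VACUITY of the residual regime: `(a, b) = (3, 2)` gives `2⁵ ∥ N` (so `N` is not square-free)
and `5 ∣ N` (an odd prime `q` to instantiate the crux at; cofactor `M = N/5 = 2⁵ · 3`). -/
example : ¬ Squarefree ((freyCurve 3 2).conductorNorm ℤ) ∧ 5 ∣ (freyCurve 3 2).conductorNorm ℤ := by
  have hab : IsCoprime (3 : ℤ) 2 := by
    rw [Int.isCoprime_iff_gcd_eq_one]; decide
  have h0 : (3 : ℤ) * 2 * (3 + 2) ≠ 0 := by norm_num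
  constructor
  · intro hsq
    have h2 := factorization_two_conductorNorm_freyCurve_normalised hab h0 (by decide) ⟨1, by norm_num⟩
    have h1 : padicValNat 2 (2 : ℤ).natAbs = 1 := by
      haveI : Fact (Nat.Prime 2) := ⟨Nat.prime_two⟩
      simp
    rw [h1, if_pos rfl] at h2
    have := hsq.natFactorization_le_one 2
    omega
  · have h := radical_natAbs_dvd_two_mul_conductorNorm_freyCurve hab h0
    have h30 : ((3 : ℤ) * 2 * (3 + 2)).natAbs = 30 := by norm_num
    rw [h30] at h
    have h5 : (5 : ℕ) ∣ UniqueFactorizationMonoid.radical (30 : ℕ) :=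
      (UniqueFactorizationMonoid.dvd_radical_iff_of_irreducible Nat.prime_five (by norm_num)).mpr
        (by norm_num)
    exact Nat.Coprime.dvd_of_dvd_mul_left (by norm_num : Nat.Coprime 5 2) (h5.trans h)

end Summit.ABC.ABC.Cruxes.DefiniteRTControlPrime.StubIdeas2G6

end
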